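import Literature.Geometry.Riemannian.CutLocusDefinable
import Literature.ModelTheory.ExponentialFields.OMinimalTriangulation
import HarnessLib

/-!
# Buchner 1977 — the cut locus is triangulable, modulo the o-minimality of `ℝ_an,exp`

Proof file (theorems only).  M. A. Buchner, *Simplicial structure of the real analytic cut locus*,
Proc. AMS 64 (1977), Theorem (p. 118): the cut locus `C(p)` of a compact real analytic Riemannian
manifold is homeomorphic to a finite simplicial complex of dimension `≤ n - 1`.  Buchner's road
(subanalyticity of `C(p)` + Hironaka's triangulation of subanalytic sets) is replaced here by the
o-minimal road assembled in this tree: `C(p) = exp_p(TCL(p))` is the image of a bounded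
subanalytic set under an analytic map, hence `ℝ_an,exp`-definable, hence — after a definable
embedding of `M` — homeomorphic to a compact `ℝ_an,exp`-definable `X ⊆ ℝᴺ`
(`CutLocusDefinable.lean`); compact definable sets in o-minimal expansions of the real field are
polyhedra (`OMinimalTriangulation.lean`, van den Dries 1998 Ch. 8 (2.9), proved in the tree); and
`ℝ_an,exp` is o-minimal (van den Dries–Miller 1994 / van den Dries–Macintyre–Marker 1994), which is
the tree's named fact `VandendriesMiller1994_realAnExp_isOMinimal` — the only remaining hypothesis.

## Main statement (proved)

* `buchner1977_cutLocus_triangulable_of_realAnExp_isOMinimal` — Buchner's theorem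
  (`buchner1977_cutLocus_triangulable`, including the dimension bound) from the o-minimality of
  `ℝ_an,exp` alone.

## References

* [Buchner1977Simplicial] M. A. Buchner, Proc. AMS 64 (1977) 118–121, Theorem p. 118.
* [Dries1998] L. van den Dries, *Tame topology and o-minimal structures* (1998), Ch. 8 (2.9).
* [VandendriesMiller1994] L. van den Dries, C. Miller, Israel J. Math. 85 (1994).
-/

noncomputable section

open Set FirstOrder

namespace Literature.Geometry.Riemannian

universe u v w

/-- **Buchner 1977 from the o-minimality of `ℝ_an,exp`.** The cut locus of a point of a compact
connected real analytic Riemannian manifold is homeomorphic to (the polyhedron of) a finite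
simplicial complex of dimension at most `n - 1` — assuming only the tree's named fact that
`ℝ_an,exp` is o-minimal; the triangulation theorem for compact definable sets (van den Dries 1998,
Ch. 8 (2.9)) is now proved in the tree (`definable_triangulation`).
[cite: Buchner1977Simplicial, Theorem p. 118] [cite: Dries1998, Ch. 8 (2.9)]
[cite: VandendriesMiller1994] -/
theorem buchner1977_cutLocus_triangulable_of_realAnExp_isOMinimal
    (hO : Literature.ModelTheory.ExponentialFields.VandendriesMiller1994_realAnExp_isOMinimal) :
    buchner1977_cutLocus_triangulable.{u, v, w} :=
  buchner1977_cutLocus_triangulable_of_isOMinimal.{u, v, w} hO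
    fun _ _ φ _ hO' N X hX hXc =>
      Literature.ModelTheory.ExponentialFields.exists_homeomorph_space_of_definable_isCompact φ hO'
        N X hX hXc

end Literature.Geometry.Riemannian
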